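import Literature.NumberTheory.QuadraticFields.ThreeTorsionMeanProgressionCountPos
import HarnessLib

/-!
# Taniguchi–Thorne, Thm 6 versus the count `M₃^±(X; m, a)` of nowhere totally ramified cubic fields in a progression (proofs)

Theorems-only companion (no definition, no named fact, no instance; D-0026) of
`Literature.NumberTheory.QuadraticFields.ThreeTorsionMean` (`tt_threeTorsion_sum_progression`,
Taniguchi–Thorne 2013, Thm 6), continuing `ThreeTorsionMeanProgressionCount(Pos).lean` (the
PROVED counts `#{0 < ±D < X fundamental, D ≡ a (mod m)} = (3/(π² m)) Π_{p ∣ m} (1 - p⁻²)⁻¹ X + O(√X)`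
for `(6a, m) = 1`) and parallel to `ThreeTorsionMeanCubicCountProofs.lean` (the case `m = 1`,
Bhargava–Taniguchi–Thorne p. 3).

Taniguchi–Thorne, §6.1 (arXiv p. 19): "we use the following classical result of Hasse, which is
proved using class field theory: There is a bijection between pairs of nontrivial 3-torsion
elements in quadratic fields `L` with `0 < ±Disc(L) < X`, and cubic fields `K` with
`0 < ±Disc(K) < X` which are not totally ramified at any prime. Under this bijection
`Disc(L) = Disc(K)` … It therefore suffices to count cubic fields which are nowhere totally
ramified. Write `M₃^±(X)` … for the counting functions of such fields."  And §6.6 (the display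
before "We readily deduce Theorem 6"): for `(m, 6a) = 1`,
`M₃^±(X; m, a) = C'₁(m, a) (C^±/(2π²)) X + K'₁(m, a) (4K^±/(5Γ(2/3)³)) X^{5/6} + (error of Thm 25)`,
`C'₁(m, a) = (1/m) Π_{p ∣ m} (1 - p⁻²)⁻¹`, `C⁻ = 3`, `C⁺ = 1`.  Theorem 6 follows as
`Σ_{D ≡ a} #Cl₃(D) = Σ_{D ≡ a} 1 + 2 M₃^±(X; m, a)` with `Σ_{D ≡ a} 1 = (3 C'₁(m, a)/π²) X + O(√X)`,
since `(3 + C^±) C'₁/π² = 3 C'₁/π² + 2 · C^± C'₁/(2π²)`.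

Hasse's bijection is class field theory and is not in the tree (its finite-group half
`#Cl₃(D) = 2·#{index-3 subgroups of Cl} + 1` is
`quadFieldThreeTorsion_eq_two_mul_card_index_three_add_one`, `ThreeTorsionProofs.lean`). This
file PROVES the elementary content of the quoted deduction for an ABSTRACT count `c : ℤ → ℕ`
subject only to the dictionary `#Cl₃(D) = 2·c(D) + 1` (in print `c(D)` = the number of nowhere
totally ramified cubic fields of discriminant `D`, so that `Σ_{0<±D<X, D ≡ a (m)} c(D)` is
`M₃^±(X; m, a)`):

* `two_term_sum_iff_of_dictionary` — bookkeeping: `Σ t = 2 Σ c + #S X` and `#S X = d X + O(√X)`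
  make `Σ_{S X} t = M X + K X^{5/6} + O_ε(X^{θ+ε})` (some `K`) equivalent to
  `Σ_{S X} c = ((M − d)/2) X + K' X^{5/6} + O_ε(X^{θ+ε})` (some `K'`), any `θ ≥ 1/2`;
* `tt_threeTorsion_sum_progression_neg_iff_cubicCount`, `…_pos_iff_cubicCount` — for
  `(6a, m) = 1`, each half of Thm 6 at `(m, a)` (main terms `(6/(π² m)) Π`, `(4/(π² m)) Π`) is
  EQUIVALENT to `M₃^±(X; m, a) = (C^±/(2π² m)) Π_{p ∣ m} (1 - p⁻²)⁻¹ X + K X^{5/6} + O_ε(X^{18/23+ε})`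
  (`3/(2π² m) Π`, `1/(2π² m) Π`), by the PROVED `Σ_{D ≡ a} 1 = (3/(π² m)) Π X + O(√X)`;
* `tt_threeTorsion_sum_progression_iff_cubicCount` — hence the named fact as a whole is
  equivalent to the family of these cubic-field statements over all `(m, a)` with `(6a, m) = 1`.

## References

* T. Taniguchi, F. Thorne, *Secondary terms in counting functions for cubic fields*, Duke Math.
  J. 162 (2013) 2451–2508 = arXiv:1102.2914, Thm 6, §6.1 (p. 19), §6.6 (displays for
  `M₃^±(X; m, a)` and `C'₁(m, a)`) [TaniguchiThorne2013].
* H. Hasse, *Arithmetische Theorie der kubischen Zahlkörper auf klassenkörpertheoretischer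
  Grundlage*, Math. Z. 31 (1930) 565–582 [Hasse1930].
-/

noncomputable section

open Finset

namespace Literature.NumberTheory.QuadraticFields

/-! ### Bookkeeping: the dictionary `t = 2c + 1` and a count `d X + O(√X)` -/

/-- **Abstract form of "`Σ #Cl₃ = Σ 1 + 2 M₃`" (Taniguchi–Thorne §6.1/§6.6).** If a statistic `t`
and a count `c` satisfy `t(D) = 2·c(D) + 1` on the finsets `S X`, and `|#S X - d X| ≤ B √X` for
`X ≥ 1`, then for any exponent `θ ≥ 1/2` the two-term asymptotic
`Σ_{D ∈ S X} t(D) = M X + K X^{5/6} + O_ε(X^{θ+ε})` (some `K`) holds iff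
`Σ_{D ∈ S X} c(D) = ((M − d)/2) X + K' X^{5/6} + O_ε(X^{θ+ε})` (some `K'`): indeed
`Σ t = 2 Σ c + #S X` and `√X ≤ X^{θ+ε}` for `X ≥ 1`. [folklore] -/
theorem two_term_sum_iff_of_dictionary {S : ℕ → Finset ℤ} {t c : ℤ → ℕ} {M d B θ : ℝ}
    (hθ : 1 / 2 ≤ θ) (htc : ∀ X : ℕ, ∀ D ∈ S X, t D = 2 * c D + 1)
    (hS : ∀ X : ℕ, 1 ≤ X → |((S X).card : ℝ) - d * X| ≤ B * Real.sqrt X) :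
    (∃ K : ℝ, ∀ ε : ℝ, 0 < ε → ∃ C : ℝ, ∀ X : ℕ, 1 ≤ X →
      |(∑ D ∈ S X, (t D : ℝ)) - M * X - K * (X : ℝ) ^ ((5 : ℝ) / 6)|
        ≤ C * (X : ℝ) ^ (θ + ε)) ↔
    (∃ K : ℝ, ∀ ε : ℝ, 0 < ε → ∃ C : ℝ, ∀ X : ℕ, 1 ≤ X →
      |(∑ D ∈ S X, (c D : ℝ)) - (M - d) / 2 * X - K * (X : ℝ) ^ ((5 : ℝ) / 6)|
        ≤ C * (X : ℝ) ^ (θ + ε)) := by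
  -- `Σ t = 2 Σ c + #S`
  have hsum : ∀ X : ℕ, (∑ D ∈ S X, (t D : ℝ)) =
      2 * (∑ D ∈ S X, (c D : ℝ)) + ((S X).card : ℝ) := by
    intro X
    rw [Finset.card_eq_sum_ones, Nat.cast_sum, Finset.mul_sum, ← Finset.sum_add_distrib]
    refine Finset.sum_congr rfl fun D hD => ?_
    rw [htc X D hD]
    push_cast
    ring
  -- `|#S X - d X| ≤ |B| X^{θ+ε}` for `X ≥ 1`
  have hcnt : ∀ {ε : ℝ}, 0 < ε → ∀ X : ℕ, 1 ≤ X →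
      |((S X).card : ℝ) - d * X| ≤ |B| * (X : ℝ) ^ (θ + ε) := by
    intro ε hε X hX
    have hX1 : (1 : ℝ) ≤ X := by exact_mod_cast hX
    refine (hS X hX).trans ?_
    have h1 : Real.sqrt X ≤ (X : ℝ) ^ (θ + ε) := by
      rw [Real.sqrt_eq_rpow]
      exact Real.rpow_le_rpow_of_exponent_le hX1 (by linarith)
    calc B * Real.sqrt X ≤ |B| * Real.sqrt X :=
          mul_le_mul_of_nonneg_right (le_abs_self B) (Real.sqrt_nonneg _)
      _ ≤ |B| * (X : ℝ) ^ (θ + ε) := mul_le_mul_of_nonneg_left h1 (abs_nonneg B)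
  constructor
  · rintro ⟨K, hK⟩
    refine ⟨K / 2, fun ε hε => ?_⟩
    obtain ⟨C, hC⟩ := hK ε hε
    refine ⟨(C + |B|) / 2, fun X hX => ?_⟩
    have h1 := hC X hX
    have h2 := hcnt hε X hX
    rw [hsum X] at h1
    have key : (∑ D ∈ S X, (c D : ℝ)) - (M - d) / 2 * X - K / 2 * (X : ℝ) ^ ((5 : ℝ) / 6)
        = ((2 * (∑ D ∈ S X, (c D : ℝ)) + ((S X).card : ℝ) - M * X
            - K * (X : ℝ) ^ ((5 : ℝ) / 6)) - (((S X).card : ℝ) - d * X)) / 2 := by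
      ring
    rw [key, abs_div, abs_two, div_le_iff₀ (by norm_num : (0 : ℝ) < 2)]
    have h4 := (abs_sub _ _).trans (add_le_add h1 h2)
    linarith
  · rintro ⟨K, hK⟩
    refine ⟨2 * K, fun ε hε => ?_⟩
    obtain ⟨C, hC⟩ := hK ε hε
    refine ⟨2 * C + |B|, fun X hX => ?_⟩
    have h1 := hC X hX
    have h2 := hcnt hε X hX
    rw [hsum X]
    have key : 2 * (∑ D ∈ S X, (c D : ℝ)) + ((S X).card : ℝ) - M * X
        - 2 * K * (X : ℝ) ^ ((5 : ℝ) / 6) =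
        2 * ((∑ D ∈ S X, (c D : ℝ)) - (M - d) / 2 * X - K * (X : ℝ) ^ ((5 : ℝ) / 6))
          + (((S X).card : ℝ) - d * X) := by
      ring
    rw [key]
    refine (abs_add_le _ _).trans ?_
    rw [abs_mul, abs_two]
    linarith

/-! ### Thm 6 at `(m, a)` versus `M₃^±(X; m, a)` -/

/-- `gcd(6a, m) = 1` forces `m ≠ 0` (as a real number). [folklore] -/
theorem natCast_ne_zero_of_gcd_six_mul {m : ℕ} {a : ℤ} (h : Int.gcd (6 * a) m = 1) :
    (m : ℝ) ≠ 0 := by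
  have hm := Nat.odd_iff.1 (odd_and_gcd_eq_one_of_gcd_six_mul h).1
  exact_mod_cast (show m ≠ 0 by omega)

/-- **Taniguchi–Thorne §6.6, imaginary quadratic fields in a progression.** Let `(6a, m) = 1` and
let `c : ℤ → ℕ` satisfy the dictionary `#Cl₃(D) = 2·c(D) + 1` on negative fundamental
discriminants (in print `c(D)` = the number of nowhere totally ramified cubic fields of
discriminant `D`, by Hasse's class-field-theoretic bijection, §6.1). Then the imaginary half of
Thm 6 at `(m, a)` (main term `(6/(π² m)) Π_{p ∣ m} (1 - p⁻²)⁻¹ X`) is EQUIVALENT to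
`M₃⁻(X; m, a) = Σ_{-X<D<0, D ≡ a (m)} c(D) = (3/(2π² m)) Π_{p ∣ m} (1 - p⁻²)⁻¹ X + K X^{5/6} + O_ε(X^{18/23+ε})`
(`C'₁(m, a) C⁻/(2π²)` with `C⁻ = 3`; secondary coefficient existential), by the PROVED count
`Σ_{D ≡ a} 1 = (3/(π² m)) Π X + O(√X)` (`abs_card_negFundDiscrs_filter_modEq_sub_le_of_gcd_six_mul`).
[cite: TaniguchiThorne2013, §6.6 (deduction of Theorem 6) and §6.1] -/
theorem tt_threeTorsion_sum_progression_neg_iff_cubicCount {m : ℕ} {a : ℤ}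
    (h : Int.gcd (6 * a) m = 1) {c : ℤ → ℕ}
    (hc : ∀ X : ℕ, ∀ D ∈ negFundDiscrs X, quadFieldThreeTorsion D = 2 * c D + 1) :
    (∃ K : ℝ, ∀ ε : ℝ, 0 < ε → ∃ C : ℝ, ∀ X : ℕ, 1 ≤ X →
      |(∑ D ∈ (negFundDiscrs X).filter (fun D => D ≡ a [ZMOD m]), (quadFieldThreeTorsion D : ℝ))
          - 6 / (Real.pi ^ 2 * m) * (∏ p ∈ m.primeFactors, (1 - 1 / (p : ℝ) ^ 2)⁻¹) * X
          - K * (X : ℝ) ^ ((5 : ℝ) / 6)| ≤ C * (X : ℝ) ^ ((18 : ℝ) / 23 + ε)) ↔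
    (∃ K : ℝ, ∀ ε : ℝ, 0 < ε → ∃ C : ℝ, ∀ X : ℕ, 1 ≤ X →
      |(∑ D ∈ (negFundDiscrs X).filter (fun D => D ≡ a [ZMOD m]), (c D : ℝ))
          - 3 / (2 * Real.pi ^ 2 * m) * (∏ p ∈ m.primeFactors, (1 - 1 / (p : ℝ) ^ 2)⁻¹) * X
          - K * (X : ℝ) ^ ((5 : ℝ) / 6)| ≤ C * (X : ℝ) ^ ((18 : ℝ) / 23 + ε)) := by
  set P : ℝ := ∏ p ∈ m.primeFactors, (1 - 1 / (p : ℝ) ^ 2)⁻¹ with hP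
  have hc' : ∀ X : ℕ, ∀ D ∈ (negFundDiscrs X).filter (fun D => D ≡ a [ZMOD m]),
      quadFieldThreeTorsion D = 2 * c D + 1 :=
    fun X D hD => hc X D (Finset.mem_filter.1 hD).1
  have hS : ∀ X : ℕ, 1 ≤ X →
      |(((negFundDiscrs X).filter (fun D => D ≡ a [ZMOD m])).card : ℝ)
        - 3 / (Real.pi ^ 2 * m) * P * X| ≤ 18 * Real.sqrt X :=
    fun X hX => abs_card_negFundDiscrs_filter_modEq_sub_le_of_gcd_six_mul h hX
  have key := two_term_sum_iff_of_dictionary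
    (S := fun X => (negFundDiscrs X).filter (fun D => D ≡ a [ZMOD m]))
    (M := 6 / (Real.pi ^ 2 * m) * P) (θ := (18 : ℝ) / 23) (by norm_num) hc' hS
  have hpi : Real.pi ^ 2 ≠ 0 := pow_ne_zero 2 Real.pi_ne_zero
  have hm : (m : ℝ) ≠ 0 := natCast_ne_zero_of_gcd_six_mul h
  rwa [show (6 / (Real.pi ^ 2 * m) * P - 3 / (Real.pi ^ 2 * m) * P) / 2
      = 3 / (2 * Real.pi ^ 2 * m) * P by field_simp; ring] at key

/-- **Taniguchi–Thorne §6.6, real quadratic fields in a progression.** With `(6a, m) = 1` and `c`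
as in `tt_threeTorsion_sum_progression_neg_iff_cubicCount` on positive fundamental discriminants,
the real half of Thm 6 at `(m, a)` (main term `(4/(π² m)) Π_{p ∣ m} (1 - p⁻²)⁻¹ X`) is EQUIVALENT
to `M₃⁺(X; m, a) = Σ_{0<D<X, D ≡ a (m)} c(D) = (1/(2π² m)) Π_{p ∣ m} (1 - p⁻²)⁻¹ X + K X^{5/6} + O_ε(X^{18/23+ε})`
(`C'₁(m, a) C⁺/(2π²)` with `C⁺ = 1`).
[cite: TaniguchiThorne2013, §6.6 (deduction of Theorem 6) and §6.1] -/
theorem tt_threeTorsion_sum_progression_pos_iff_cubicCount {m : ℕ} {a : ℤ}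
    (h : Int.gcd (6 * a) m = 1) {c : ℤ → ℕ}
    (hc : ∀ X : ℕ, ∀ D ∈ posFundDiscrs X, quadFieldThreeTorsion D = 2 * c D + 1) :
    (∃ K : ℝ, ∀ ε : ℝ, 0 < ε → ∃ C : ℝ, ∀ X : ℕ, 1 ≤ X →
      |(∑ D ∈ (posFundDiscrs X).filter (fun D => D ≡ a [ZMOD m]), (quadFieldThreeTorsion D : ℝ))
          - 4 / (Real.pi ^ 2 * m) * (∏ p ∈ m.primeFactors, (1 - 1 / (p : ℝ) ^ 2)⁻¹) * X
          - K * (X : ℝ) ^ ((5 : ℝ) / 6)| ≤ C * (X : ℝ) ^ ((18 : ℝ) / 23 + ε)) ↔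
    (∃ K : ℝ, ∀ ε : ℝ, 0 < ε → ∃ C : ℝ, ∀ X : ℕ, 1 ≤ X →
      |(∑ D ∈ (posFundDiscrs X).filter (fun D => D ≡ a [ZMOD m]), (c D : ℝ))
          - 1 / (2 * Real.pi ^ 2 * m) * (∏ p ∈ m.primeFactors, (1 - 1 / (p : ℝ) ^ 2)⁻¹) * X
          - K * (X : ℝ) ^ ((5 : ℝ) / 6)| ≤ C * (X : ℝ) ^ ((18 : ℝ) / 23 + ε)) := by
  set P : ℝ := ∏ p ∈ m.primeFactors, (1 - 1 / (p : ℝ) ^ 2)⁻¹ with hP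
  have hc' : ∀ X : ℕ, ∀ D ∈ (posFundDiscrs X).filter (fun D => D ≡ a [ZMOD m]),
      quadFieldThreeTorsion D = 2 * c D + 1 :=
    fun X D hD => hc X D (Finset.mem_filter.1 hD).1
  have hS : ∀ X : ℕ, 1 ≤ X →
      |(((posFundDiscrs X).filter (fun D => D ≡ a [ZMOD m])).card : ℝ)
        - 3 / (Real.pi ^ 2 * m) * P * X| ≤ 18 * Real.sqrt X :=
    fun X hX => abs_card_posFundDiscrs_filter_modEq_sub_le_of_gcd_six_mul h hX
  have key := two_term_sum_iff_of_dictionary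
    (S := fun X => (posFundDiscrs X).filter (fun D => D ≡ a [ZMOD m]))
    (M := 4 / (Real.pi ^ 2 * m) * P) (θ := (18 : ℝ) / 23) (by norm_num) hc' hS
  have hpi : Real.pi ^ 2 ≠ 0 := pow_ne_zero 2 Real.pi_ne_zero
  have hm : (m : ℝ) ≠ 0 := natCast_ne_zero_of_gcd_six_mul h
  rwa [show (4 / (Real.pi ^ 2 * m) * P - 3 / (Real.pi ^ 2 * m) * P) / 2
      = 1 / (2 * Real.pi ^ 2 * m) * P by field_simp; ring] at key

/-! ### The named fact as a statement about cubic fields in progressions -/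

/-- **Taniguchi–Thorne, Thm 6 ⟺ the `M₃^±(X; m, a)` asymptotics of §6.6.** For any `c : ℤ → ℕ`
with `#Cl₃(D) = 2·c(D) + 1` for all `D` (in print: `c(D)` = the number of nowhere totally
ramified cubic fields of discriminant `D` — Hasse, §6.1; off fundamental discriminants both sides
are the junk value `1 = 2·0 + 1`), the named fact `tt_threeTorsion_sum_progression` is
EQUIVALENT to: for all `m ≥ 1`, `a` with `(6a, m) = 1`,
`M₃⁻(X; m, a) = (3/(2π² m)) Π_{p ∣ m} (1 - p⁻²)⁻¹ X + K⁻ X^{5/6} + O_ε(X^{18/23+ε})` and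
`M₃⁺(X; m, a) = (1/(2π² m)) Π_{p ∣ m} (1 - p⁻²)⁻¹ X + K⁺ X^{5/6} + O_ε(X^{18/23+ε})`
(the printed `C'₁(m, a) C^±/(2π²) X + K'₁(m, a) (4K^±/(5Γ(2/3)³)) X^{5/6}` with the secondary
coefficients existential and the error per `(m, a, ε)`).
[cite: TaniguchiThorne2013, §6.6 (deduction of Theorem 6) and §6.1] -/
theorem tt_threeTorsion_sum_progression_iff_cubicCount {c : ℤ → ℕ}
    (hc : ∀ D : ℤ, quadFieldThreeTorsion D = 2 * c D + 1) :
    tt_threeTorsion_sum_progression ↔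
    ∀ (m : ℕ) (a : ℤ), 1 ≤ m → Int.gcd (6 * a) m = 1 →
      (∃ K : ℝ, ∀ ε : ℝ, 0 < ε → ∃ C : ℝ, ∀ X : ℕ, 1 ≤ X →
        |(∑ D ∈ (negFundDiscrs X).filter (fun D => D ≡ a [ZMOD m]), (c D : ℝ))
            - 3 / (2 * Real.pi ^ 2 * m) * (∏ p ∈ m.primeFactors, (1 - 1 / (p : ℝ) ^ 2)⁻¹) * X
            - K * (X : ℝ) ^ ((5 : ℝ) / 6)| ≤ C * (X : ℝ) ^ ((18 : ℝ) / 23 + ε)) ∧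
      (∃ K : ℝ, ∀ ε : ℝ, 0 < ε → ∃ C : ℝ, ∀ X : ℕ, 1 ≤ X →
        |(∑ D ∈ (posFundDiscrs X).filter (fun D => D ≡ a [ZMOD m]), (c D : ℝ))
            - 1 / (2 * Real.pi ^ 2 * m) * (∏ p ∈ m.primeFactors, (1 - 1 / (p : ℝ) ^ 2)⁻¹) * X
            - K * (X : ℝ) ^ ((5 : ℝ) / 6)| ≤ C * (X : ℝ) ^ ((18 : ℝ) / 23 + ε)) := by
  refine forall_congr' fun m => forall_congr' fun a => forall_congr' fun _ =>
    forall_congr' fun h => ?_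
  exact and_congr (tt_threeTorsion_sum_progression_neg_iff_cubicCount h fun X D _ => hc D)
    (tt_threeTorsion_sum_progression_pos_iff_cubicCount h fun X D _ => hc D)

end Literature.NumberTheory.QuadraticFields

end
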